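import Summits.ResolutionOfSingularities.ResolutionOfSingularities.Theorems.PurelyInseparableDim4SwapTransport
import HarnessLib
import HarnessLib.Audit.Tags

/-!
# Purely inseparable four-folds — a unit-class frame with TWO free letters propagates through a slot step taken at
# corresponding points of two presentations (cell `res-dim4-pi`, K2(p) lane, slice B; K24b-R1 «rotation residual of the
# C∞ assembly», file `unitFrame_step₂`)

[OURS · counted 0 · cell `res-dim4-pi` · K2(p) lane holder res-dim4-p-12 g3's ruling (bus 2026-08-29 04:33:16Z): «typ-1 g3
takes K24b-R1 (b) solo: `unitFrame_step₂`» = res-dim4-p-11 g3's SN3 `SwapTransport.unitFrame_step` (p691059) extended to two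
non-diagonal free letters; seat res-dim4-typ-1 g3.]  Nothing here proves K2(p)/K2(5), `NoIsolatedTrap 5 5` or resolution of
singularities in dimension ≥ 4 / characteristic `p` — NOT proved.  AI kernel work, weaker than expert review.

WHY TWO LETTERS.  The C∞ frame of the window (slice B, K24b) moves BOTH free letters: `x_f ↦ x_f + φ(x_λ, x_μ, x_u)` (linear
straightening of the cone, res-dim4-p-1/p-11) and `x_u ↦ x_u + ψ(x_λ, x_μ)` (the second Tschirnhaus,
`…ResConeCInfSecondTschirnhaus`).  So the relation between a REAL chain state and its framed / re-presented VIRTUAL partner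
is a substitution of SLOT-UNIT CLASS along a letter bijection `π` (virtual ↦ real): DIAGONAL WITH A UNIT on the two SLOT
letters, `θ(x_{π i}) = x_i · e_i`, `e_i(0) ≠ 0` (`i ∉ {u, f}`: the boundary hyperplanes correspond), and merely ORIGIN-FIXING on
the two free letters, `θ(x_{π u})(0) = θ(x_{π f})(0) = 0` (SN3's one-letter shape `x_f · e_f + G` is the special case; the
invertibility of the tangent map is NOT part of the class — it is carried by the consumer through the explicit linear data
below, which is what a rotation step needs).  A real slot step may translate BOTH free letters (`b` supported on
`{π u, π f}`), the virtual one too (`b′` on `{u, f}`); the two 1-JET RELATIONS `hγu`, `hγf` say the two points correspond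
under the tangent map of `θ`.  **`unitFrame_step₂`**: the children are again related in the same class along the same `π`,
error in `𝔪₀^{M − p}`, and the tangent rows of the new frame are explicit: `e′_ℓ(0) = e_ℓ(0)`, `e′_i(0) = e_i(0)·w` (slot
`i ≠ ℓ`), `coeff_{x_k} θ′(x_{π g}) = w · coeff_{x_k} θ(x_{π g})` for the free letters `g` and every `k ≠ ℓ`, `w · e_ℓ(0) = 1` — so
`det (tangent θ′) = det (tangent θ) · (nonzero)`.  Proof = SN3's §4 with the free letters' images divided by `x_ℓ` as a whole
(res-dim4-p-11 g3's §§1–3 helpers imported BY NAME).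
[cite: Hauser2010, §§F–G (chart expressions of a point blowup; cleaning)] [folklore]
bears_on: LADDER-RESOLUTION:D157-DOOR2 (res-dim4-pi · K2(p) · slice B · K24b-R1).  Supports
stmt-ResolutionOfSingularities-16155 (helper).
-/

set_option linter.dupNamespace false -- mandated namespace of this single-conjunct summit

noncomputable section

namespace Summit.ResolutionOfSingularities.ResolutionOfSingularities.Theorems.PIDim4

namespace SwapTransport

open MvPolynomial Finset
open Literature.AlgebraicGeometry.Resolution
open Literature.AlgebraicGeometry.Resolution.CentreBlowup
open Literature.AlgebraicGeometry.Resolution.Hauser2010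

variable {K : Type} [Field K]

/-! ## §1 One non-diagonal letter through the blow-up substitution -/

/-- **`G ∘ β = x_ℓ · G̃`** for an origin-free `G` and the blow-up substitution `β` of the chart `ℓ` at the point `b′`
(`b′_ℓ = 0`): `G̃(0) = ∂G/∂x_ℓ(0) + Σ_{i ≠ ℓ} ∂G/∂x_i(0)·b′_i` and `coeff_{x_k} G̃ = coeff_{x_k} G` for every `k ≠ ℓ`. [folklore]
[cite: Hauser2010, §F] -/
theorem exists_blowup_factor {ℓ : Fin 4} (b' : Fin 4 → K) {G : MvPolynomial (Fin 4) K} (hG0 : constantCoeff G = 0) :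
    ∃ Gt : MvPolynomial (Fin 4) K,
      aeval (fun i => if i = ℓ then (X ℓ : MvPolynomial (Fin 4) K) else X ℓ * (X i + C (b' i))) G = X ℓ * Gt ∧
      constantCoeff Gt = coeff (Finsupp.single ℓ 1) G +
        ∑ i ∈ Finset.univ.erase ℓ, coeff (Finsupp.single i 1) G * b' i ∧
      ∀ k, k ≠ ℓ → coeff (Finsupp.single k 1) Gt = coeff (Finsupp.single k 1) G := by
  classical
  obtain ⟨β, hβ⟩ : ∃ β : Fin 4 → MvPolynomial (Fin 4) K,
      β = fun i => if i = ℓ then (X ℓ : MvPolynomial (Fin 4) K) else X ℓ * (X i + C (b' i)) := ⟨_, rfl⟩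
  rw [show (fun i : Fin 4 => if i = ℓ then (X ℓ : MvPolynomial (Fin 4) K) else X ℓ * (X i + C (b' i))) = β
    from hβ.symm]
  have hβℓ : β ℓ = X ℓ := by rw [hβ]; simp
  obtain ⟨L, hL⟩ : ∃ L : MvPolynomial (Fin 4) K, L = C (coeff (Finsupp.single ℓ 1) G) +
      ∑ i ∈ Finset.univ.erase ℓ, C (coeff (Finsupp.single i 1) G) * (X i + C (b' i)) := ⟨_, rfl⟩
  have hG₁β : aeval β (∑ i, C (coeff (Finsupp.single i 1) G) * X i) = X ℓ * L := by
    rw [map_sum, ← Finset.add_sum_erase Finset.univ _ (Finset.mem_univ ℓ), hL, mul_add, Finset.mul_sum]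
    simp only [map_mul, aeval_C, algebraMap_eq, aeval_X, hβℓ]
    rw [mul_comm]
    refine congrArg _ (Finset.sum_congr rfl fun i hi => ?_)
    rw [hβ]
    simp only [if_neg (Finset.ne_of_mem_erase hi)]
    ring
  obtain ⟨H₂, hH₂⟩ := Ideal.mem_span_singleton'.mp (hβ ▸ aeval_blowup_mem_span_pow ℓ b' (SwapNorm.sub_linearForm_mem_sq hG0))
  refine ⟨L + X ℓ * H₂, ?_, ?_, fun k hk => ?_⟩
  · have h1 : aeval β G = aeval β (∑ i, C (coeff (Finsupp.single i 1) G) * X i) +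
        aeval β (G - ∑ i, C (coeff (Finsupp.single i 1) G) * X i) := by rw [← map_add]; ring_nf
    rw [h1, hG₁β, ← hH₂]
    ring
  · rw [map_add, map_mul, constantCoeff_X, zero_mul, add_zero, hL, map_add, constantCoeff_C, map_sum]
    refine congrArg _ (Finset.sum_congr rfl fun i _ => ?_)
    rw [map_mul, constantCoeff_C, map_add, constantCoeff_X, constantCoeff_C, zero_add]
  · have hns : ℓ ∉ (Finsupp.single k 1).support := by
      rw [Finsupp.mem_support_iff, Finsupp.single_eq_of_ne hk.symm]; exact fun h => h rfl
    have hone : ∀ i : Fin 4, coeff (Finsupp.single k 1) (C (coeff (Finsupp.single i 1) G) * (X i + C (b' i))) =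
        if i = k then coeff (Finsupp.single k 1) G else 0 := by
      intro i
      rw [coeff_C_mul, coeff_add, coeff_C, if_neg (Ne.symm (Finsupp.single_ne_zero.mpr one_ne_zero)), add_zero,
        coeff_X]
      by_cases hik : i = k
      · rw [hik, if_pos rfl, if_pos rfl, mul_one]
      · rw [if_neg (fun h => hik ((Finsupp.single_left_inj one_ne_zero).mp h)), if_neg hik, mul_zero]
    rw [coeff_add, coeff_X_mul', if_neg hns, add_zero, hL, coeff_add, coeff_C,
      if_neg (Ne.symm (Finsupp.single_ne_zero.mpr one_ne_zero)), zero_add, coeff_sum]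
    simp_rw [hone]
    rw [Finset.sum_ite_eq' (Finset.univ.erase ℓ) k, if_pos (Finset.mem_erase.mpr ⟨hk, Finset.mem_univ k⟩)]

/-- **The new image of a free letter.**  With `W` a flat inverse of `e_ℓ ∘ β` modulo `𝔪₀ᴹ` (flat along `x_ℓ`, `W(0) = w`) and
`G̃` from `exists_blowup_factor`, the polynomial `W·G̃ − γ` has constant term `w·G̃(0) − γ` (zero iff the 1-JET RELATION holds)
and linear coefficient `w·coeff_{x_k} G̃` at every letter `k ≠ ℓ`. [folklore] -/
theorem newImage_coeffs {ℓ k : Fin 4} (hkℓ : k ≠ ℓ) {W Gt : MvPolynomial (Fin 4) K} {w γ : K}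
    (hWc : constantCoeff W = w) (hWflat : W - C w ∈ Ideal.span {(X ℓ : MvPolynomial (Fin 4) K)}) :
    constantCoeff (W * Gt - C γ) = w * constantCoeff Gt - γ ∧
      coeff (Finsupp.single k 1) (W * Gt - C γ) = w * coeff (Finsupp.single k 1) Gt := by
  refine ⟨?_, ?_⟩
  · rw [map_sub, map_mul, constantCoeff_C, hWc]
  · rw [coeff_sub, coeff_single_mul_of_sub_C_mem hkℓ.symm hWflat, coeff_C,
      if_neg (Ne.symm (Finsupp.single_ne_zero.mpr one_ne_zero)), sub_zero]

/-! ## §2 THE TRANSPORT of a two-letter unit-class frame through a slot step -/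

/-- **Slot-unit-class frame with two free letters through a slot step** (`unitFrame_step₂`; K24b-R1).  Letters: `π` the
bijection VIRTUAL ↦ REAL, `u ≠ f` the virtual free letters, `ℓ ∉ {u, f}` the (virtual) chart letter, a slot.  From
`B.F = clean(Uᵖ · θ(A.F)) + E`, `E ∈ 𝔪₀ᴹ`, `θ` of slot-unit class along `π`, a real translation `b` supported on `{π u, π f}`
and a virtual one `b′` supported on `{u, f}` related by the two 1-jet relations `hγu`, `hγf`: the children `step ℓ b′ B` and
`step (π ℓ) b A` satisfy the same relation with error in `𝔪₀^{M − p}`, with the explicit tangent data of the new frame.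
[OURS] [cite: Hauser2010, §§F–G] -/
theorem unitFrame_step₂ (p : ℕ) [Fact p.Prime] [CharP K p] [DecidableEq K] (π : Equiv.Perm (Fin 4)) {u f : Fin 4}
    (huf : u ≠ f) {M : ℕ} {A B : State K} {θ e : Fin 4 → MvPolynomial (Fin 4) K} {U E : MvPolynomial (Fin 4) K}
    (hθi : ∀ i, i ≠ u → i ≠ f → θ (π i) = X i * e i) (he : ∀ i, i ≠ u → i ≠ f → constantCoeff (e i) ≠ 0)
    (hu0 : constantCoeff (θ (π u)) = 0) (hf0 : constantCoeff (θ (π f)) = 0)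
    (hU : constantCoeff U ≠ 0) (hE : E ∈ originIdeal K ^ M)
    (hrel : B.F = deletePthPowers p (U ^ p * aeval θ A.F) + E)
    (hA : (p : ℕ∞) ≤ ordAlong Finset.univ A.F) (hB : (p : ℕ∞) ≤ ordAlong Finset.univ B.F)
    {ℓ : Fin 4} (hℓu : ℓ ≠ u) (hℓf : ℓ ≠ f) {b b' : Fin 4 → K}
    (hbi : ∀ i, i ≠ u → i ≠ f → b (π i) = 0) (hb'i : ∀ i, i ≠ u → i ≠ f → b' i = 0)
    (hγu : b (π u) * constantCoeff (e ℓ) = coeff (Finsupp.single ℓ 1) (θ (π u)) +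
      coeff (Finsupp.single u 1) (θ (π u)) * b' u + coeff (Finsupp.single f 1) (θ (π u)) * b' f)
    (hγf : b (π f) * constantCoeff (e ℓ) = coeff (Finsupp.single ℓ 1) (θ (π f)) +
      coeff (Finsupp.single u 1) (θ (π f)) * b' u + coeff (Finsupp.single f 1) (θ (π f)) * b' f) :
    ∃ (θ' e' : Fin 4 → MvPolynomial (Fin 4) K) (U' E' : MvPolynomial (Fin 4) K) (w : K),
      (∀ i, i ≠ u → i ≠ f → θ' (π i) = X i * e' i) ∧ (∀ i, i ≠ u → i ≠ f → constantCoeff (e' i) ≠ 0) ∧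
      constantCoeff (θ' (π u)) = 0 ∧ constantCoeff (θ' (π f)) = 0 ∧ constantCoeff U' ≠ 0 ∧
      E' ∈ originIdeal K ^ (M - p) ∧
      (step p Finset.univ ℓ b' B).F =
        deletePthPowers p (U' ^ p * aeval θ' (step p Finset.univ (π ℓ) b A).F) + E' ∧
      w * constantCoeff (e ℓ) = 1 ∧ constantCoeff (e' ℓ) = constantCoeff (e ℓ) ∧
      (∀ i, i ≠ ℓ → constantCoeff (e' i) = constantCoeff (e i) * w) ∧
      (∀ k, k ≠ ℓ → coeff (Finsupp.single k 1) (θ' (π u)) = w * coeff (Finsupp.single k 1) (θ (π u))) ∧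
      (∀ k, k ≠ ℓ → coeff (Finsupp.single k 1) (θ' (π f)) = w * coeff (Finsupp.single k 1) (θ (π f))) := by
  classical
  -- the two points and the two blow-up substitutions
  have hπℓu : π ℓ ≠ π u := fun h => hℓu (π.injective h)
  have hπℓf : π ℓ ≠ π f := fun h => hℓf (π.injective h)
  have hb'ℓ : b' ℓ = 0 := hb'i ℓ hℓu hℓf
  have hbℓ : b (π ℓ) = 0 := hbi ℓ hℓu hℓf
  obtain ⟨β, hβ⟩ : ∃ β : Fin 4 → MvPolynomial (Fin 4) K,
      β = fun i => if i = ℓ then (X ℓ : MvPolynomial (Fin 4) K) else X ℓ * (X i + C (b' i)) := ⟨_, rfl⟩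
  obtain ⟨α, hα⟩ : ∃ α : Fin 4 → MvPolynomial (Fin 4) K,
      α = fun i => if i = π ℓ then (X (π ℓ) : MvPolynomial (Fin 4) K) else X (π ℓ) * (X i + C (b i)) := ⟨_, rfl⟩
  have hβℓ : β ℓ = X ℓ := by rw [hβ]; simp
  have hβk : ∀ k, k ≠ ℓ → β k = X ℓ * (X k + C (b' k)) := fun k hk => by rw [hβ]; simp [hk]
  have hβi : ∀ i, i ≠ ℓ → i ≠ u → i ≠ f → β i = X ℓ * X i := fun i hiℓ hiu hif => by
    rw [hβk i hiℓ, hb'i i hiu hif, C_0, add_zero]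
  have hαℓ : α (π ℓ) = X (π ℓ) := by rw [hα]; simp
  have hαk : ∀ k, k ≠ ℓ → α (π k) = X (π ℓ) * (X (π k) + C (b (π k))) := fun k hk => by
    have hne : π k ≠ π ℓ := fun h => hk (π.injective h)
    rw [hα]; simp [hne]
  have hαi : ∀ i, i ≠ ℓ → i ≠ u → i ≠ f → α (π i) = X (π ℓ) * X (π i) := fun i hiℓ hiu hif => by
    rw [hαk i hiℓ, hbi i hiu hif, C_0, add_zero]
  have hβ0 : ∀ i, constantCoeff (β i) = 0 := fun i => by rw [hβ]; exact constantCoeff_blowup ℓ b' i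
  -- the chart identities `F∘β = x_ℓᵖ · T_B`, `F∘α = x_{πℓ}ᵖ · T_A`
  have hBch : aeval β B.F = X ℓ ^ p * PointBlowup.translate b' (chartTransform p Finset.univ ℓ B.F) := by
    rw [hβ]; exact FreeTailProof.aeval_blowup_eq p ℓ b' hb'ℓ B.F hB
  have hAch : aeval α A.F = X (π ℓ) ^ p * PointBlowup.translate b (chartTransform p Finset.univ (π ℓ) A.F) := by
    rw [hα]; exact FreeTailProof.aeval_blowup_eq p (π ℓ) b hbℓ A.F hA
  -- the units `e_i ∘ β`, flat along `x_ℓ`, and the flat inverse `W` of `e_ℓ ∘ β`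
  have hεc : ∀ H : MvPolynomial (Fin 4) K, constantCoeff (aeval β H) = constantCoeff H :=
    fun H => CoordChange.constantCoeff_aeval_of_origin β hβ0 H
  have hεflat : ∀ H : MvPolynomial (Fin 4) K,
      aeval β H - C (constantCoeff (aeval β H)) ∈ Ideal.span {(X ℓ : MvPolynomial (Fin 4) K)} := fun H => by
    rw [hεc, hβ]; exact aeval_blowup_sub_C_mem ℓ b' H
  have hεflat' : ∀ H : MvPolynomial (Fin 4) K,
      aeval β H - C (constantCoeff H) ∈ Ideal.span {(X ℓ : MvPolynomial (Fin 4) K)} := fun H => by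
    have h := hεflat H
    rwa [hεc] at h
  obtain ⟨W, hWc, hWflat, hWinv⟩ := exists_flat_inv (by rw [hεc]; exact he ℓ hℓu hℓf) (hεflat (e ℓ)) M
  rw [hεc] at hWc
  obtain ⟨w, hw⟩ : ∃ w : K, w = constantCoeff W := ⟨_, rfl⟩
  rw [← hw] at hWc hWflat
  have hwne : w ≠ 0 := left_ne_zero_of_mul_eq_one hWc
  -- `θ(π u) ∘ β = x_ℓ · G̃_u`, `θ(π f) ∘ β = x_ℓ · G̃_f`
  obtain ⟨Gtu, hGuβ, hGtu0, hGtu1⟩ := exists_blowup_factor (ℓ := ℓ) b' hu0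
  obtain ⟨Gtf, hGfβ, hGtf0, hGtf1⟩ := exists_blowup_factor (ℓ := ℓ) b' hf0
  rw [← hβ] at hGuβ hGfβ
  -- the sums over `i ≠ ℓ` have only the two free letters
  have hsum : ∀ G : MvPolynomial (Fin 4) K, ∑ i ∈ Finset.univ.erase ℓ, coeff (Finsupp.single i 1) G * b' i =
      coeff (Finsupp.single u 1) G * b' u + coeff (Finsupp.single f 1) G * b' f := by
    intro G
    have hu : u ∈ Finset.univ.erase ℓ := Finset.mem_erase.mpr ⟨hℓu.symm, Finset.mem_univ u⟩
    have hf : f ∈ Finset.univ.erase ℓ := Finset.mem_erase.mpr ⟨hℓf.symm, Finset.mem_univ f⟩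
    refine Finset.sum_eq_add_of_mem u f hu hf huf fun i _ hi => ?_
    rw [hb'i i hi.1 hi.2, mul_zero]
  have hGtu0' : constantCoeff Gtu = coeff (Finsupp.single ℓ 1) (θ (π u)) +
      coeff (Finsupp.single u 1) (θ (π u)) * b' u + coeff (Finsupp.single f 1) (θ (π u)) * b' f := by
    rw [hGtu0, hsum, add_assoc]
  have hGtf0' : constantCoeff Gtf = coeff (Finsupp.single ℓ 1) (θ (π f)) +
      coeff (Finsupp.single u 1) (θ (π f)) * b' u + coeff (Finsupp.single f 1) (θ (π f)) * b' f := by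
    rw [hGtf0, hsum, add_assoc]
  -- the new data
  obtain ⟨e', he'⟩ : ∃ e' : Fin 4 → MvPolynomial (Fin 4) K,
      e' = fun i => aeval β (e i) * (if i = ℓ then 1 else W) := ⟨_, rfl⟩
  obtain ⟨Gu', hGu'⟩ : ∃ Gu' : MvPolynomial (Fin 4) K, Gu' = W * Gtu - C (b (π u)) := ⟨_, rfl⟩
  obtain ⟨Gf', hGf'⟩ : ∃ Gf' : MvPolynomial (Fin 4) K, Gf' = W * Gtf - C (b (π f)) := ⟨_, rfl⟩
  obtain ⟨θ', hθ'⟩ : ∃ θ' : Fin 4 → MvPolynomial (Fin 4) K,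
      θ' = fun k => if π.symm k = u then Gu' else if π.symm k = f then Gf' else X (π.symm k) * e' (π.symm k) :=
    ⟨_, rfl⟩
  obtain ⟨U', hU'⟩ : ∃ U' : MvPolynomial (Fin 4) K, U' = aeval β U * aeval β (e ℓ) := ⟨_, rfl⟩
  have hθ'i : ∀ i, i ≠ u → i ≠ f → θ' (π i) = X i * e' i := fun i hiu hif => by
    rw [hθ']; simp only [Equiv.symm_apply_apply, if_neg hiu, if_neg hif]
  have hθ'u : θ' (π u) = Gu' := by rw [hθ']; simp only [Equiv.symm_apply_apply, if_true]
  have hθ'f : θ' (π f) = Gf' := by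
    rw [hθ']; simp only [Equiv.symm_apply_apply, if_neg huf.symm, if_true]
  have he'ℓ : e' ℓ = aeval β (e ℓ) := by rw [he']; simp
  have he'i : ∀ i, i ≠ ℓ → e' i = aeval β (e i) * W := fun i hi => by rw [he']; simp [hi]
  -- the letterwise congruence `θ⁺∘α ≡ β∘θ mod 𝔪₀ᴹ`
  have hfree : ∀ (g : Fin 4) (Gtg : MvPolynomial (Fin 4) K), g ≠ ℓ → aeval β (θ (π g)) = X ℓ * Gtg →
      θ' (π g) = W * Gtg - C (b (π g)) → aeval θ' (α (π g)) - aeval β (θ (π g)) ∈ originIdeal K ^ M := by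
    intro g Gtg hgℓ hGgβ hθ'g
    rw [hαk g hgℓ, map_mul, map_add, aeval_X, aeval_X, aeval_C, algebraMap_eq, hθ'i ℓ hℓu hℓf, he'ℓ, hθ'g, hGgβ]
    rw [show X ℓ * aeval β (e ℓ) * (W * Gtg - C (b (π g)) + C (b (π g))) - X ℓ * Gtg =
        X ℓ * Gtg * (W * aeval β (e ℓ) - 1) by ring]
    exact Ideal.mul_mem_left _ _ hWinv
  have hΘ : ∀ k, aeval θ' (α k) - aeval β (θ k) ∈ originIdeal K ^ M := by
    intro k
    obtain ⟨i, rfl⟩ := π.surjective k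
    by_cases hiℓ : i = ℓ
    · subst hiℓ
      rw [hαℓ, aeval_X, hθ'i _ hℓu hℓf, he'ℓ, hθi _ hℓu hℓf, map_mul, aeval_X, hβℓ, sub_self]
      exact Submodule.zero_mem _
    · by_cases hiu : i = u
      · rw [hiu]
        exact hfree u Gtu hℓu.symm hGuβ (by rw [hθ'u, hGu'])
      · by_cases hif : i = f
        · rw [hif]
          exact hfree f Gtf hℓf.symm hGfβ (by rw [hθ'f, hGf'])
        · rw [hαi i hiℓ hiu hif, map_mul, aeval_X, aeval_X, hθ'i ℓ hℓu hℓf, he'ℓ, hθ'i i hiu hif, he'i i hiℓ,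
            hθi i hiu hif, map_mul, aeval_X, hβi i hiℓ hiu hif]
          rw [show X ℓ * aeval β (e ℓ) * (X i * (aeval β (e i) * W)) - X ℓ * X i * aeval β (e i) =
              X ℓ * X i * aeval β (e i) * (W * aeval β (e ℓ) - 1) by ring]
          exact Ideal.mul_mem_left _ _ hWinv
  have hD : aeval (fun k => aeval θ' (α k)) A.F - aeval (fun k => aeval β (θ k)) A.F ∈ originIdeal K ^ M :=
    ApproxCoordChange.aeval_sub_aeval_mem hΘ A.F
  -- abbreviations for the two point transforms and the error
  obtain ⟨TA, hTA⟩ : ∃ TA : MvPolynomial (Fin 4) K,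
      TA = PointBlowup.translate b (chartTransform p Finset.univ (π ℓ) A.F) := ⟨_, rfl⟩
  obtain ⟨TB, hTB⟩ : ∃ TB : MvPolynomial (Fin 4) K,
      TB = PointBlowup.translate b' (chartTransform p Finset.univ ℓ B.F) := ⟨_, rfl⟩
  have hstepB : (step p Finset.univ ℓ b' B).F = deletePthPowers p TB := by rw [hTB]; rfl
  have hstepA : (step p Finset.univ (π ℓ) b A).F = deletePthPowers p TA := by rw [hTA]; rfl
  rw [← hTB] at hBch
  rw [← hTA] at hAch
  obtain ⟨D, hDdef⟩ : ∃ D : MvPolynomial (Fin 4) K,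
      D = aeval (fun k => aeval θ' (α k)) A.F - aeval (fun k => aeval β (θ k)) A.F := ⟨_, rfl⟩
  rw [← hDdef] at hD
  -- the key identity `x_ℓᵖ · clean T_B = x_ℓᵖ · clean(U⁺ᵖ · θ⁺(clean T_A)) + (clean(E∘β) − clean((U∘β)ᵖ · D))`
  have hθ'ℓp : aeval θ' (X (π ℓ) ^ p * TA) = (X ℓ * aeval β (e ℓ)) ^ p * aeval θ' TA := by
    rw [map_mul, map_pow, aeval_X, hθ'i ℓ hℓu hℓf, he'ℓ]
  have hkey : X ℓ ^ p * deletePthPowers p TB =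
      X ℓ ^ p * deletePthPowers p (U' ^ p * aeval θ' (deletePthPowers p TA)) +
        (deletePthPowers p (aeval β E) - deletePthPowers p (aeval β U ^ p * D)) := by
    have h1 : X ℓ ^ p * deletePthPowers p TB = deletePthPowers p (aeval β B.F) := by
      rw [← deletePthPowers_X_pow_mul, hBch]
    have h2 : aeval β (U ^ p * aeval θ A.F) = X ℓ ^ p * (U' ^ p * aeval θ' TA) - aeval β U ^ p * D := by
      rw [map_mul, map_pow, ApproxCoordChange.aeval_aeval, hDdef, ← ApproxCoordChange.aeval_aeval θ' α, hAch, hθ'ℓp, hU']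
      ring
    rw [h1, hrel, map_add, deletePthPowers_add, deletePthPowers_aeval_deletePthPowers, h2, SwapNorm.deletePthPowers_sub',
      deletePthPowers_X_pow_mul, SwapNorm.deletePthPowers_mul_aeval_deletePthPowers]
    ring
  obtain ⟨E', hE'⟩ : ∃ E' : MvPolynomial (Fin 4) K,
      E' = deletePthPowers p TB - deletePthPowers p (U' ^ p * aeval θ' (deletePthPowers p TA)) := ⟨_, rfl⟩
  have hE'M : X ℓ ^ p * E' ∈ originIdeal K ^ M := by
    rw [hE', mul_sub, hkey, add_sub_cancel_left]
    refine Ideal.sub_mem _ (SwapNorm.deletePthPowers_mem_pow p (SwapNorm.aeval_mem_pow hβ0 hE)) ?_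
    exact SwapNorm.deletePthPowers_mem_pow p (Ideal.mul_mem_left _ _ hD)
  -- the coefficient bookkeeping of the two new free images
  have hnu := fun (k : Fin 4) (hk : k ≠ ℓ) => newImage_coeffs (γ := b (π u)) (Gt := Gtu) hk hw.symm hWflat
  have hnf := fun (k : Fin 4) (hk : k ≠ ℓ) => newImage_coeffs (γ := b (π f)) (Gt := Gtf) hk hw.symm hWflat
  refine ⟨θ', e', U', E', w, hθ'i, fun i hiu hif => ?_, ?_, ?_, ?_, mem_pow_sub_of_X_pow_mul_mem hE'M, ?_, hWc, ?_,
    fun i hi => ?_, fun k hk => ?_, fun k hk => ?_⟩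
  · -- units on the slots
    by_cases hiℓ : i = ℓ
    · rw [hiℓ, he'ℓ, hεc]; exact he ℓ hℓu hℓf
    · rw [he'i i hiℓ, map_mul, hεc, ← hw]; exact mul_ne_zero (he i hiu hif) hwne
  · -- `θ⁺(x_{π u})(0) = 0`: the 1-jet relation `hγu`
    rw [hθ'u, hGu', (hnu u hℓu.symm).1, hGtu0']
    linear_combination (-w) * hγu + b (π u) * hWc
  · -- `θ⁺(x_{π f})(0) = 0`: the 1-jet relation `hγf`
    rw [hθ'f, hGf', (hnf f hℓf.symm).1, hGtf0']
    linear_combination (-w) * hγf + b (π f) * hWc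
  · rw [hU', map_mul, hεc, hεc]; exact mul_ne_zero hU (he ℓ hℓu hℓf)
  · rw [hstepB, hstepA, hE']
    ring
  · rw [he'ℓ, hεc]
  · rw [he'i i hi, map_mul, hεc, ← hw]
  · rw [hθ'u, hGu', (hnu k hk).2, hGtu1 k hk]
  · rw [hθ'f, hGf', (hnf k hk).2, hGtf1 k hk]

end SwapTransport

end Summit.ResolutionOfSingularities.ResolutionOfSingularities.Theorems.PIDim4

end
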